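import Mathlib.Analysis.InnerProductSpace.Adjoint
import Mathlib.Analysis.InnerProductSpace.Calculus
import Mathlib.Analysis.Calculus.MeanValue
import Literature.Analysis.FluidPDE.LinearizedHsEuler
import Literature.Analysis.FunctionSpaces.TorusCalculusProofs
import Literature.Analysis.FunctionSpaces.TorusSpaceTime
import Literature.Analysis.FunctionSpaces.TorusTestFunction
import HarnessLib

/-!
# Linearised hard-sphere Euler: smoothness, linearity and forward/adjoint duality (proofs)

Companion of `Literature.Analysis.FluidPDE.LinearizedHsEuler` (definitions `HsState`, `consState`,
`hsEulerFlux`, `fluxJacobian`, `IsLinearizedHsEulerSolution` (a), `IsAdjointLinearizedHsEulerSolution`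
(b)). Everything here is proved:

* smoothness: `contDiff_hsStateMk`, `contDiff_consState`, `isSmoothSpaceTimeOn_consState` (the
  conservative state field of an `IsHardSphereEulerSolution` is jointly smooth,
  `IsHardSphereEulerSolution.isSmoothSpaceTimeOn_consState`), `HsState.contDiffOn_velocity/
  temperature/pressure`, `contDiffOn_hsEulerFlux` (a `C^n` equation of state `Z = hsCompressibility`
  on an open set `W` of reduced densities makes `Fⱼ` `C^n` on the open set of non-vacuum states
  with `ρσ³ ∈ W`), and `isSmooth_fluxJacobian_comp` / `isSmoothSpaceTimeOn_fluxJacobian_comp`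
  (then the Jacobian field `y ↦ Aⱼ(U(y))` along a smooth state field is smooth — the hypothesis
  `hA` of the linearity and duality statements);
* linearity: `0` solves both systems, sums and scalar multiples of solutions are solutions
  (`IsLinearizedHsEulerSolution.zero/add/smul`, `IsAdjointLinearizedHsEulerSolution.zero/add/smul`);
* the pointwise **duality identity** `IsLinearizedHsEulerSolution.inner_timeDerivWithin_add`:
  for a forward solution `V` and an adjoint solution `ψ`,
  `⟪∂ₜV, ψ⟫ + ⟪V, ∂ₛψ⟫ = -∑ⱼ ∂ⱼ ⟪AⱼV, ψ⟫` at every `(s, x)` (from `⟪V, Aⱼᵀ∂ⱼψ⟫ = ⟪AⱼV, ∂ⱼψ⟫`,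
  `ContinuousLinearMap.adjoint_inner_right`, and the Leibniz rule `Torus.partialDeriv_inner`);
* its integrated form, the **duality (Green's identity)** for the first-order operator
  `∂ₜ + ∑ⱼ ∂ⱼ(Aⱼ ·)` and its formal adjoint `-∂ₜ - ∑ⱼ Aⱼᵀ∂ⱼ` on `[0,t] × 𝕋³` (no boundary terms on
  the torus, `Torus.integral_partialDeriv_eq_zero_holds`; differentiation under `∫_{𝕋³}`,
  `Torus.IsSmoothSpaceTimeOn.hasDerivWithinAt_integral`):
  `IsLinearizedHsEulerSolution.hasDerivWithinAt_integral_inner` (zero derivative within `[0,t]`),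
  `IsLinearizedHsEulerSolution.integral_inner_eq` (`∫ ⟪V(s,x), ψ(s,x)⟫ dx = ∫ ⟪V(t,x), ψ(t,x)⟫ dx`
  for all `s ∈ [0,t]`) and the Green's-function form
  `IsLinearizedHsEulerSolution.integral_mul_apply_eq_integral_inner`: for the terminal datum
  `ψ(t) = χ eₖ`, `∫ χ V(t)ₖ = ∫ ⟪V(0), ψ(0)⟫` — the response of the `k`-th conserved field at time `t`
  is the initial perturbation paired with the backward adjoint solution (Spohn 1991, §7.1,
  (7.18)–(7.24): `⟨ξₜ(ψ), ξ₀(φ)⟩ = ⟨ψ | e^{At} C φ⟩`, `ξₜ(φ) = ξ₀(e^{A*t}φ) + …` at equilibrium).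

## References

* H. Spohn, *Large Scale Dynamics of Interacting Particles*, Springer 1991, §7.1, (7.17)–(7.24),
  pp. 88–89 = PDF pp. 95–96.
* L. C. Evans, *Partial Differential Equations*, 2nd ed., AMS 2010, App. C.2 (integration by
  parts; empty boundary on the torus).
-/

noncomputable section

open MeasureTheory Set Filter
open _root_.Topology
open scoped InnerProductSpace ContDiff BigOperators
open Literature.Analysis.FunctionSpaces
open Literature.MathematicalPhysics.KineticTheory

namespace Literature.Analysis.FluidPDE

/-! ### Smoothness of the conservative variables and of the linearised fluxes -/

/-- `HsState.mk` is jointly smooth (it is linear) in `(ρ, m, E)`. [folklore] -/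
theorem contDiff_hsStateMk {n : WithTop ℕ∞} :
    ContDiff ℝ n (fun p : ℝ × V3 × ℝ => HsState.mk p.1 p.2.1 p.2.2) := by
  rw [contDiff_euclidean]
  intro i
  fin_cases i
  · exact contDiff_fst
  · exact (contDiff_piLp_apply (p := 2) (E := fun _ : Fin 3 => ℝ) (i := 0)).comp
      (contDiff_fst.comp contDiff_snd)
  · exact (contDiff_piLp_apply (p := 2) (E := fun _ : Fin 3 => ℝ) (i := 1)).comp
      (contDiff_fst.comp contDiff_snd)
  · exact (contDiff_piLp_apply (p := 2) (E := fun _ : Fin 3 => ℝ) (i := 2)).comp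
      (contDiff_fst.comp contDiff_snd)
  · exact contDiff_snd.comp contDiff_snd

/-- `HsState.mk` of smooth component fields is smooth. [folklore] -/
theorem ContDiff.hsStateMk {X : Type*} [NormedAddCommGroup X] [NormedSpace ℝ X] {n : WithTop ℕ∞}
    {a c : X → ℝ} {b : X → V3} (ha : ContDiff ℝ n a) (hb : ContDiff ℝ n b) (hc : ContDiff ℝ n c) :
    ContDiff ℝ n (fun x => HsState.mk (a x) (b x) (c x)) :=
  contDiff_hsStateMk.comp (ha.prodMk (hb.prodMk hc))

/-- `HsState.mk` of component fields smooth on a set is smooth on that set. [folklore] -/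
theorem ContDiffOn.hsStateMk {X : Type*} [NormedAddCommGroup X] [NormedSpace ℝ X]
    {n : WithTop ℕ∞} {s : Set X} {a c : X → ℝ} {b : X → V3} (ha : ContDiffOn ℝ n a s)
    (hb : ContDiffOn ℝ n b s) (hc : ContDiffOn ℝ n c s) :
    ContDiffOn ℝ n (fun x => HsState.mk (a x) (b x) (c x)) s :=
  contDiff_hsStateMk.comp_contDiffOn (ha.prodMk (hb.prodMk hc))

/-- The conservative variables depend smoothly (polynomially) on the primitive ones:
`(ρ, u, θ) ↦ consState ρ u θ` is `C^∞`. [folklore] -/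
theorem contDiff_consState {n : WithTop ℕ∞} :
    ContDiff ℝ n (fun p : ℝ × V3 × ℝ => consState p.1 p.2.1 p.2.2) := by
  unfold consState totalEnergyDensity
  refine ContDiff.hsStateMk contDiff_fst (contDiff_fst.smul (contDiff_fst.comp contDiff_snd)) ?_
  exact contDiff_fst.mul ((((contDiff_fst.comp contDiff_snd).norm_sq ℝ).div_const 2).add
    (contDiff_const.mul (contDiff_snd.comp contDiff_snd)))

/-- The conservative state field `(t, x) ↦ consState (ρ t x) (u t x) (θ t x)` of jointly smooth
primitive fields is jointly smooth (in particular for an `IsHardSphereEulerSolution`). [folklore] -/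
theorem isSmoothSpaceTimeOn_consState {S : Set ℝ} {ρ θ : ℝ → T3 → ℝ} {u : ℝ → T3 → V3}
    (hρ : Torus.IsSmoothSpaceTimeOn S ρ) (hu : Torus.IsSmoothSpaceTimeOn S u)
    (hθ : Torus.IsSmoothSpaceTimeOn S θ) :
    Torus.IsSmoothSpaceTimeOn S (fun t x => consState (ρ t x) (u t x) (θ t x)) :=
  contDiff_consState.comp_contDiffOn (hρ.prodMk (hu.prodMk hθ))

/-- The conservative state field of a classical hard-sphere Euler solution is jointly smooth on
`[0, T)`. [folklore] -/
theorem _root_.Literature.MathematicalPhysics.KineticTheory.IsHardSphereEulerSolution.isSmoothSpaceTimeOn_consState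
    {σ T : ℝ} {ρ θ : ℝ → T3 → ℝ} {u : ℝ → T3 → V3} (h : IsHardSphereEulerSolution σ T ρ u θ) :
    Torus.IsSmoothSpaceTimeOn (Ico 0 T) (fun t x => consState (ρ t x) (u t x) (θ t x)) :=
  Literature.Analysis.FluidPDE.isSmoothSpaceTimeOn_consState h.smooth_density h.smooth_velocity
    h.smooth_temperature

/-- The coordinate projections `density`, `momentum`, `energy` are smooth (linear). [folklore] -/
theorem HsState.contDiff_density {n : WithTop ℕ∞} : ContDiff ℝ n HsState.density :=
  contDiff_piLp_apply (p := 2) (E := fun _ : Fin 5 => ℝ) (i := 0)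

/-- The energy projection is smooth (linear). [folklore] -/
theorem HsState.contDiff_energy {n : WithTop ℕ∞} : ContDiff ℝ n HsState.energy :=
  contDiff_piLp_apply (p := 2) (E := fun _ : Fin 5 => ℝ) (i := 4)

/-- The momentum projection is smooth (linear). [folklore] -/
theorem HsState.contDiff_momentum {n : WithTop ℕ∞} : ContDiff ℝ n HsState.momentum := by
  rw [contDiff_euclidean]
  intro j
  exact contDiff_piLp_apply (p := 2) (E := fun _ : Fin 5 => ℝ) (i := HsState.momentumIdx j)

/-- Away from vacuum the velocity `u = m/ρ` depends smoothly on the state. [folklore] -/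
theorem HsState.contDiffOn_velocity {n : WithTop ℕ∞} :
    ContDiffOn ℝ n HsState.velocity {U : HsState | U.density ≠ 0} :=
  (contDiff_density.contDiffOn.inv fun _ hU => hU).smul contDiff_momentum.contDiffOn

/-- Away from vacuum the temperature `θ(U)` depends smoothly on the state. [folklore] -/
theorem HsState.contDiffOn_temperature {n : WithTop ℕ∞} :
    ContDiffOn ℝ n HsState.temperature {U : HsState | U.density ≠ 0} := by
  unfold HsState.temperature
  refine contDiffOn_const.mul ((contDiff_energy.contDiffOn.div contDiff_density.contDiffOn
    fun _ hU => hU).sub ((contDiffOn_velocity.norm_sq ℝ).div_const 2))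

/-- **Smooth equation of state ⇒ smooth pressure law in conservative variables**: if the
compressibility factor `Z = hsCompressibility` is `C^n` on an open set `W` of reduced densities,
then `U ↦ P_σ(U)` is `C^n` on the open set of non-vacuum states with `ρσ³ ∈ W`. [folklore] -/
theorem HsState.contDiffOn_pressure {n : WithTop ℕ∞} {σ : ℝ} {W : Set ℝ}
    (hZ : ContDiffOn ℝ n hsCompressibility W) :
    ContDiffOn ℝ n (HsState.pressure σ) {U : HsState | U.density ≠ 0 ∧ U.density * σ ^ 3 ∈ W} := by
  have hsub : {U : HsState | U.density ≠ 0 ∧ U.density * σ ^ 3 ∈ W} ⊆ {U : HsState | U.density ≠ 0} :=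
    fun _ hU => hU.1
  unfold HsState.pressure hsPressure
  refine ((contDiff_density.contDiffOn.mul (contDiffOn_temperature.mono hsub)).mul ?_)
  exact hZ.comp (contDiff_density.mul contDiff_const).contDiffOn fun _ hU => hU.2

/-- **Smooth equation of state ⇒ smooth fluxes**: if `Z = hsCompressibility` is `C^n` on an open
set `W` of reduced densities, the flux `Fⱼ` is `C^n` on the (open) set of non-vacuum states with
`ρσ³ ∈ W` — the hypothesis `hF` of `isSmooth_fluxJacobian_comp` (with `n = ∞`; e.g. `W` a
neighbourhood of `[0, η₀)` on which the virial series converges). [folklore] -/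
theorem contDiffOn_hsEulerFlux {n : WithTop ℕ∞} {σ : ℝ} {W : Set ℝ}
    (hZ : ContDiffOn ℝ n hsCompressibility W) (j : Fin 3) :
    ContDiffOn ℝ n (hsEulerFlux σ j) {U : HsState | U.density ≠ 0 ∧ U.density * σ ^ 3 ∈ W} := by
  have hsub : {U : HsState | U.density ≠ 0 ∧ U.density * σ ^ 3 ∈ W} ⊆ {U : HsState | U.density ≠ 0} :=
    fun _ hU => hU.1
  have hv : ContDiffOn ℝ n HsState.velocity {U : HsState | U.density ≠ 0 ∧ U.density * σ ^ 3 ∈ W} :=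
    HsState.contDiffOn_velocity.mono hsub
  have hvj : ContDiffOn ℝ n (fun U : HsState => U.velocity j)
      {U : HsState | U.density ≠ 0 ∧ U.density * σ ^ 3 ∈ W} :=
    (contDiff_piLp_apply (p := 2) (E := fun _ : Fin 3 => ℝ) (i := j)).comp_contDiffOn hv
  have hmj : ContDiff ℝ n (fun U : HsState => U.momentum j) :=
    (contDiff_piLp_apply (p := 2) (E := fun _ : Fin 3 => ℝ) (i := j)).comp HsState.contDiff_momentum
  have hp := HsState.contDiffOn_pressure (σ := σ) hZ
  unfold hsEulerFlux
  refine ContDiffOn.hsStateMk hmj.contDiffOn ?_ ?_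
  · exact (hvj.smul HsState.contDiff_momentum.contDiffOn).add (hp.smul contDiffOn_const)
  · exact (HsState.contDiff_energy.contDiffOn.add hp).mul hvj

/-- The set of non-vacuum states with reduced density in an open set `W` is open. [folklore] -/
theorem isOpen_setOf_density_ne_zero_and_mem {σ : ℝ} {W : Set ℝ} (hW : IsOpen W) :
    IsOpen {U : HsState | U.density ≠ 0 ∧ U.density * σ ^ 3 ∈ W} :=
  have hc : Continuous HsState.density := (HsState.contDiff_density (n := 0)).continuous
  (isOpen_ne_fun hc continuous_const).inter (hW.preimage (hc.mul continuous_const))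

/-- A smooth field of (real) continuous linear maps applied to a smooth field on the torus is
smooth (torus version of `ContDiff.clm_apply`; the name `Torus.IsSmooth.clm_apply` is taken by the
complex-linear variant of `TorusSymbolCalculus`). [folklore] -/
theorem isSmooth_clm_apply {d : Type*} [Fintype d]
    {F G : Type*} [NormedAddCommGroup F] [NormedSpace ℝ F] [NormedAddCommGroup G] [NormedSpace ℝ G]
    {A : UnitAddTorus d → F →L[ℝ] G} {v : UnitAddTorus d → F} (hA : Torus.IsSmooth A)
    (hv : Torus.IsSmooth v) : Torus.IsSmooth (fun y => A y (v y)) :=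
  ContDiff.clm_apply hA hv

/-- Space–time version of `isSmooth_clm_apply`. [folklore] -/
theorem isSmoothSpaceTimeOn_clm_apply {d : Type*}
    [Fintype d] {F G : Type*} [NormedAddCommGroup F] [NormedSpace ℝ F] [NormedAddCommGroup G]
    [NormedSpace ℝ G] {S : Set ℝ} {A : ℝ → UnitAddTorus d → F →L[ℝ] G}
    {v : ℝ → UnitAddTorus d → F} (hA : Torus.IsSmoothSpaceTimeOn S A)
    (hv : Torus.IsSmoothSpaceTimeOn S v) : Torus.IsSmoothSpaceTimeOn S (fun t y => A t y (v t y)) :=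
  ContDiffOn.clm_apply hA hv

/-- **Smooth equation of state ⇒ smooth Jacobian field.** If the flux `Fⱼ` is `C^∞` on an open
set `O` of states containing the values of a smooth state field `U : 𝕋³ → ℝ⁵`, then
`y ↦ Aⱼ(U(y)) = DFⱼ(U(y))` is a smooth field of linear maps (Mathlib `ContDiffOn.fderiv_of_isOpen`
and the chain rule). This is how the smoothness hypotheses of the duality theorems are met for a
background bounded away from vacuum with an analytic (virial) equation of state. [folklore] -/
theorem isSmooth_fluxJacobian_comp {σ : ℝ} {j : Fin 3} {O : Set HsState} (hO : IsOpen O)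
    (hF : ContDiffOn ℝ ∞ (hsEulerFlux σ j) O) {U : T3 → HsState} (hU : Torus.IsSmooth U)
    (hUO : ∀ y, U y ∈ O) : Torus.IsSmooth (fun y => fluxJacobian σ j (U y)) := by
  have hG : ContDiffOn ℝ ∞ (fderiv ℝ (hsEulerFlux σ j)) O := hF.fderiv_of_isOpen hO le_rfl
  exact hG.comp_contDiff hU fun z => hUO _

/-- Space–time version of `isSmooth_fluxJacobian_comp`: along a jointly smooth state field with
values in an open set where the flux is smooth, `(t, y) ↦ Aⱼ(U(t,y))` is jointly smooth. [folklore] -/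
theorem isSmoothSpaceTimeOn_fluxJacobian_comp {σ : ℝ} {j : Fin 3} {O : Set HsState} (hO : IsOpen O)
    (hF : ContDiffOn ℝ ∞ (hsEulerFlux σ j) O) {S : Set ℝ} {U : ℝ → T3 → HsState}
    (hU : Torus.IsSmoothSpaceTimeOn S U) (hUO : ∀ t ∈ S, ∀ y, U t y ∈ O) :
    Torus.IsSmoothSpaceTimeOn S (fun t y => fluxJacobian σ j (U t y)) := by
  have hG : ContDiffOn ℝ ∞ (fderiv ℝ (hsEulerFlux σ j)) O := hF.fderiv_of_isOpen hO le_rfl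
  refine hG.comp hU ?_
  rintro ⟨t, z⟩ ⟨ht, -⟩
  exact hUO t ht _

/-! ### Elementary torus-calculus helpers -/

section Helpers

variable {d : Type*} [Fintype d] [DecidableEq d]
variable {F : Type*} [NormedAddCommGroup F] [NormedSpace ℝ F]

omit [Fintype d] in
/-- Partial derivatives of a constant vanish. [folklore] -/
theorem partialDeriv_fun_const (i : d) (c : F) (x : UnitAddTorus d) :
    Torus.partialDeriv i (fun _ => c) x = 0 := by
  simp [Torus.partialDeriv, Torus.lineDeriv]

omit [Fintype d] [DecidableEq d] in
/-- The one-sided time derivative of a time–space constant vanishes. [folklore] -/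
theorem timeDerivWithin_fun_const (S : Set ℝ) (c : F) (t : ℝ) (x : UnitAddTorus d) :
    Torus.timeDerivWithin S (fun (_ : ℝ) (_ : UnitAddTorus d) => c) t x = 0 := by
  simp [Torus.timeDerivWithin]

omit [DecidableEq d] in
/-- Additivity of the one-sided time derivative for jointly smooth fields. [folklore] -/
theorem timeDerivWithin_fun_add {S : Set ℝ} {a b : ℝ → UnitAddTorus d → F}
    (ha : Torus.IsSmoothSpaceTimeOn S a) (hb : Torus.IsSmoothSpaceTimeOn S b) {t : ℝ} (ht : t ∈ S)
    (x : UnitAddTorus d) :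
    Torus.timeDerivWithin S (fun s y => a s y + b s y) t x =
      Torus.timeDerivWithin S a t x + Torus.timeDerivWithin S b t x :=
  derivWithin_fun_add (ha.hasDerivWithinAt_slice ht x).differentiableWithinAt
    (hb.hasDerivWithinAt_slice ht x).differentiableWithinAt

omit [DecidableEq d] in
/-- Homogeneity of the one-sided time derivative for jointly smooth fields. [folklore] -/
theorem timeDerivWithin_fun_const_smul {S : Set ℝ} {a : ℝ → UnitAddTorus d → F}
    (ha : Torus.IsSmoothSpaceTimeOn S a) (c : ℝ) {t : ℝ} (ht : t ∈ S) (x : UnitAddTorus d) :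
    Torus.timeDerivWithin S (fun s y => c • a s y) t x = c • Torus.timeDerivWithin S a t x :=
  derivWithin_fun_const_smul c (ha.hasDerivWithinAt_slice ht x).differentiableWithinAt

/-- Additivity of partial derivatives (pointwise form of `Torus.partialDeriv_add`). [folklore] -/
theorem partialDeriv_fun_add {f g : UnitAddTorus d → F} (hf : Torus.IsSmooth f) (hg : Torus.IsSmooth g)
    (i : d) (x : UnitAddTorus d) :
    Torus.partialDeriv i (fun y => f y + g y) x = Torus.partialDeriv i f x + Torus.partialDeriv i g x := by
  exact congr_fun (Torus.partialDeriv_add (hf.isContDiff (by simp)) (hg.isContDiff (by simp)) i) x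

/-- Homogeneity of partial derivatives (pointwise form of `Torus.partialDeriv_const_smul`). [folklore] -/
theorem partialDeriv_fun_const_smul {f : UnitAddTorus d → F} (hf : Torus.IsSmooth f) (c : ℝ) (i : d)
    (x : UnitAddTorus d) :
    Torus.partialDeriv i (fun y => c • f y) x = c • Torus.partialDeriv i f x := by
  exact congr_fun (Torus.partialDeriv_const_smul (hf.isContDiff (by simp)) c i) x

end Helpers

/-! ### Linearity of the two systems -/

namespace IsLinearizedHsEulerSolution

variable {σ T : ℝ} {ρ θ : ℝ → T3 → ℝ} {u : ℝ → T3 → V3} {V W : ℝ → T3 → HsState}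

/-- The zero field solves the linearised system. [folklore] -/
theorem zero : IsLinearizedHsEulerSolution σ T ρ u θ (fun _ _ => 0) where
  smooth := contDiffOn_const
  eqn t _ x := by
    simp only [map_zero, partialDeriv_fun_const, Finset.sum_const_zero, add_zero]
    exact timeDerivWithin_fun_const _ _ _ _

/-- Superposition: sums of solutions are solutions (given smooth Jacobian fields along the
background, so that the linearised fluxes are smooth and `∂ⱼ` is additive on them). [folklore] -/
theorem add (hV : IsLinearizedHsEulerSolution σ T ρ u θ V) (hW : IsLinearizedHsEulerSolution σ T ρ u θ W)
    (hA : ∀ j, ∀ t ∈ Ico 0 T,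
      Torus.IsSmooth (fun y => fluxJacobian σ j (consState (ρ t y) (u t y) (θ t y)))) :
    IsLinearizedHsEulerSolution σ T ρ u θ (fun t x => V t x + W t x) where
  smooth := hV.smooth.add hW.smooth
  eqn t ht x := by
    have h1 := hV.eqn t ht x
    have h2 := hW.eqn t ht x
    have hsum : ∀ j, Torus.partialDeriv j (fun y =>
        fluxJacobian σ j (consState (ρ t y) (u t y) (θ t y)) (V t y + W t y)) x =
        Torus.partialDeriv j (fun y => fluxJacobian σ j (consState (ρ t y) (u t y) (θ t y)) (V t y)) x +
        Torus.partialDeriv j (fun y => fluxJacobian σ j (consState (ρ t y) (u t y) (θ t y)) (W t y)) x := by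
      intro j
      simp only [map_add]
      exact partialDeriv_fun_add (isSmooth_clm_apply (hA j t ht) (hV.smooth.isSmooth_slice ht))
        (isSmooth_clm_apply (hA j t ht) (hW.smooth.isSmooth_slice ht)) j x
    rw [timeDerivWithin_fun_add hV.smooth hW.smooth ht x, Finset.sum_congr rfl fun j _ => hsum j,
      Finset.sum_add_distrib]
    calc _ = (Torus.timeDerivWithin (Ico 0 T) V t x + ∑ j, Torus.partialDeriv j
              (fun y => fluxJacobian σ j (consState (ρ t y) (u t y) (θ t y)) (V t y)) x) +
            (Torus.timeDerivWithin (Ico 0 T) W t x + ∑ j, Torus.partialDeriv j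
              (fun y => fluxJacobian σ j (consState (ρ t y) (u t y) (θ t y)) (W t y)) x) := by abel
      _ = 0 := by rw [h1, h2, add_zero]

/-- Homogeneity: scalar multiples of solutions are solutions (same proviso as `add`). [folklore] -/
theorem smul (hV : IsLinearizedHsEulerSolution σ T ρ u θ V) (c : ℝ)
    (hA : ∀ j, ∀ t ∈ Ico 0 T,
      Torus.IsSmooth (fun y => fluxJacobian σ j (consState (ρ t y) (u t y) (θ t y)))) :
    IsLinearizedHsEulerSolution σ T ρ u θ (fun t x => c • V t x) where
  smooth := hV.smooth.const_smul c
  eqn t ht x := by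
    have h1 := hV.eqn t ht x
    have hsm : ∀ j, Torus.partialDeriv j (fun y =>
        fluxJacobian σ j (consState (ρ t y) (u t y) (θ t y)) (c • V t y)) x =
        c • Torus.partialDeriv j (fun y => fluxJacobian σ j (consState (ρ t y) (u t y) (θ t y)) (V t y)) x := by
      intro j
      simp only [map_smul]
      exact partialDeriv_fun_const_smul (isSmooth_clm_apply (hA j t ht) (hV.smooth.isSmooth_slice ht)) c j x
    rw [timeDerivWithin_fun_const_smul hV.smooth c ht x, Finset.sum_congr rfl fun j _ => hsm j,
      ← Finset.smul_sum, ← smul_add, h1, smul_zero]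

end IsLinearizedHsEulerSolution

namespace IsAdjointLinearizedHsEulerSolution

variable {σ t : ℝ} {ρ θ : ℝ → T3 → ℝ} {u : ℝ → T3 → V3} {ψ φ : ℝ → T3 → HsState}

/-- The zero field solves the adjoint system. [folklore] -/
theorem zero : IsAdjointLinearizedHsEulerSolution σ t ρ u θ (fun _ _ => 0) where
  smooth := contDiffOn_const
  eqn s _ x := by
    have h0 : ∀ j, Torus.partialDeriv j ((fun (_ : ℝ) (_ : T3) => (0 : HsState)) s) x = 0 :=
      fun j => partialDeriv_fun_const j (0 : HsState) x
    simp only [h0, map_zero, Finset.sum_const_zero, add_zero]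
    exact timeDerivWithin_fun_const _ _ _ _

/-- Superposition for the adjoint system: sums of solutions are solutions (no hypothesis on the
background is needed: the transposed Jacobians act linearly on `∂ⱼψ`). [folklore] -/
theorem add (hψ : IsAdjointLinearizedHsEulerSolution σ t ρ u θ ψ)
    (hφ : IsAdjointLinearizedHsEulerSolution σ t ρ u θ φ) :
    IsAdjointLinearizedHsEulerSolution σ t ρ u θ (fun s x => ψ s x + φ s x) where
  smooth := hψ.smooth.add hφ.smooth
  eqn s hs x := by
    have h1 := hψ.eqn s hs x
    have h2 := hφ.eqn s hs x
    have hd : ∀ j, Torus.partialDeriv j ((fun s' y => ψ s' y + φ s' y) s) x =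
        Torus.partialDeriv j (ψ s) x + Torus.partialDeriv j (φ s) x := fun j =>
      partialDeriv_fun_add (hψ.smooth.isSmooth_slice hs) (hφ.smooth.isSmooth_slice hs) j x
    simp only [hd, map_add]
    rw [timeDerivWithin_fun_add hψ.smooth hφ.smooth hs x, Finset.sum_add_distrib]
    calc _ = (Torus.timeDerivWithin (Icc 0 t) ψ s x + ∑ j, ContinuousLinearMap.adjoint
              (fluxJacobian σ j (consState (ρ s x) (u s x) (θ s x))) (Torus.partialDeriv j (ψ s) x)) +
            (Torus.timeDerivWithin (Icc 0 t) φ s x + ∑ j, ContinuousLinearMap.adjoint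
              (fluxJacobian σ j (consState (ρ s x) (u s x) (θ s x))) (Torus.partialDeriv j (φ s) x)) := by
          abel
      _ = 0 := by rw [h1, h2, add_zero]

/-- Homogeneity for the adjoint system. [folklore] -/
theorem smul (hψ : IsAdjointLinearizedHsEulerSolution σ t ρ u θ ψ) (c : ℝ) :
    IsAdjointLinearizedHsEulerSolution σ t ρ u θ (fun s x => c • ψ s x) where
  smooth := hψ.smooth.const_smul c
  eqn s hs x := by
    have h1 := hψ.eqn s hs x
    have hd : ∀ j, Torus.partialDeriv j ((fun s' y => c • ψ s' y) s) x =
        c • Torus.partialDeriv j (ψ s) x := fun j =>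
      partialDeriv_fun_const_smul (hψ.smooth.isSmooth_slice hs) c j x
    simp only [hd, map_smul]
    rw [timeDerivWithin_fun_const_smul hψ.smooth c hs x, ← Finset.smul_sum, ← smul_add, h1, smul_zero]

end IsAdjointLinearizedHsEulerSolution

/-! ### Duality between the forward and the adjoint system -/

namespace IsLinearizedHsEulerSolution

variable {σ T t : ℝ} {ρ θ : ℝ → T3 → ℝ} {u : ℝ → T3 → V3} {V ψ : ℝ → T3 → HsState}

/-- **Pointwise duality identity.** For a forward solution `V` on `[0,T)` and an adjoint solution
`ψ` on `[0,t]`, `t < T`, at every `(s, x) ∈ [0,t] × 𝕋³`: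
`⟪∂ₜV, ψ⟫ + ⟪V, ∂ₛψ⟫ = -∑ⱼ ∂ⱼ ⟪Aⱼ(U) V, ψ⟫` — the local conservation law behind Green's
identity for the pair (system, adjoint system), from `⟪V, Aⱼᵀ∂ⱼψ⟫ = ⟪AⱼV, ∂ⱼψ⟫` and the Leibniz
rule. Hypothesis `hA`: the Jacobian fields `y ↦ Aⱼ(U(s,y))` are smooth (see
`isSmooth_fluxJacobian_comp`). [folklore] -/
theorem inner_timeDerivWithin_add (hV : IsLinearizedHsEulerSolution σ T ρ u θ V)
    (hψ : IsAdjointLinearizedHsEulerSolution σ t ρ u θ ψ) (htT : t < T) {s : ℝ} (hs : s ∈ Icc 0 t)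
    (hA : ∀ j, Torus.IsSmooth (fun y => fluxJacobian σ j (consState (ρ s y) (u s y) (θ s y))))
    (x : T3) :
    ⟪Torus.timeDerivWithin (Ico 0 T) V s x, ψ s x⟫_ℝ + ⟪V s x, Torus.timeDerivWithin (Icc 0 t) ψ s x⟫_ℝ =
      -∑ j, Torus.partialDeriv j
        (fun y => ⟪fluxJacobian σ j (consState (ρ s y) (u s y) (θ s y)) (V s y), ψ s y⟫_ℝ) x := by
  have hsT : s ∈ Ico 0 T := ⟨hs.1, hs.2.trans_lt htT⟩
  have hVs : Torus.IsSmooth (V s) := hV.smooth.isSmooth_slice hsT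
  have hψs : Torus.IsSmooth (ψ s) := hψ.smooth.isSmooth_slice hs
  have hw : ∀ j, Torus.IsSmooth
      (fun y => fluxJacobian σ j (consState (ρ s y) (u s y) (θ s y)) (V s y)) :=
    fun j => isSmooth_clm_apply (hA j) hVs
  have e1 : Torus.timeDerivWithin (Ico 0 T) V s x = -∑ j, Torus.partialDeriv j
      (fun y => fluxJacobian σ j (consState (ρ s y) (u s y) (θ s y)) (V s y)) x :=
    eq_neg_of_add_eq_zero_left (hV.eqn s hsT x)
  have e2 : Torus.timeDerivWithin (Icc 0 t) ψ s x = -∑ j, ContinuousLinearMap.adjoint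
      (fluxJacobian σ j (consState (ρ s x) (u s x) (θ s x))) (Torus.partialDeriv j (ψ s) x) :=
    eq_neg_of_add_eq_zero_left (hψ.eqn s hs x)
  have e3 : ∀ j, Torus.partialDeriv j
      (fun y => ⟪fluxJacobian σ j (consState (ρ s y) (u s y) (θ s y)) (V s y), ψ s y⟫_ℝ) x =
      ⟪fluxJacobian σ j (consState (ρ s x) (u s x) (θ s x)) (V s x), Torus.partialDeriv j (ψ s) x⟫_ℝ +
      ⟪Torus.partialDeriv j (fun y => fluxJacobian σ j (consState (ρ s y) (u s y) (θ s y)) (V s y)) x,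
        ψ s x⟫_ℝ :=
    fun j => Torus.partialDeriv_inner ((hw j).isContDiff (by simp)) (hψs.isContDiff (by simp)) j x
  rw [e1, e2, inner_neg_left, inner_neg_right, sum_inner, inner_sum]
  simp only [ContinuousLinearMap.adjoint_inner_right, e3, Finset.sum_add_distrib]
  ring

/-- **Duality (Green's identity) between the linearised system and its adjoint.** For a forward
solution `V` on `[0,T)` and an adjoint solution `ψ` on `[0,t]`, `t < T`, with smooth Jacobian
fields along the background on `[0,t]`, the pairing `s ↦ ∫_{𝕋³} ⟪V(s,x), ψ(s,x)⟫ dx` has zero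
derivative within `[0,t]` at every `s ∈ [0,t]`: differentiate under the integral
(`Torus.IsSmoothSpaceTimeOn.hasDerivWithinAt_integral`), apply the pointwise identity and
`∫ ∂ⱼ(·) = 0` on the torus (`Torus.integral_partialDeriv_eq_zero_holds`). [folklore] -/
theorem hasDerivWithinAt_integral_inner (hV : IsLinearizedHsEulerSolution σ T ρ u θ V)
    (hψ : IsAdjointLinearizedHsEulerSolution σ t ρ u θ ψ) (htT : t < T) (ht : 0 < t)
    (hA : ∀ j, ∀ s ∈ Icc 0 t,
      Torus.IsSmooth (fun y => fluxJacobian σ j (consState (ρ s y) (u s y) (θ s y))))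
    {s : ℝ} (hs : s ∈ Icc 0 t) :
    HasDerivWithinAt (fun τ => ∫ x, ⟪V τ x, ψ τ x⟫_ℝ) 0 (Icc 0 t) s := by
  have hsub : Icc 0 t ⊆ Ico 0 T := fun τ hτ => ⟨hτ.1, hτ.2.trans_lt htT⟩
  have hsT : s ∈ Ico 0 T := hsub hs
  have hV' : Torus.IsSmoothSpaceTimeOn (Icc 0 t) V := hV.smooth.mono hsub
  have hpair : Torus.IsSmoothSpaceTimeOn (Icc 0 t) (fun τ x => ⟪V τ x, ψ τ x⟫_ℝ) :=
    hV'.inner hψ.smooth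
  have hU : UniqueDiffOn ℝ (Icc 0 t) := uniqueDiffOn_Icc ht
  have hderiv := hpair.hasDerivWithinAt_integral (convex_Icc 0 t) hs
  -- identify the integrand of the derivative and show it integrates to zero
  have hVt : Torus.timeDerivWithin (Icc 0 t) V s = Torus.timeDerivWithin (Ico 0 T) V s := by
    funext x
    exact ((hV.smooth.hasDerivWithinAt_slice hsT x).mono hsub).derivWithin (hU s hs)
  have hw : ∀ j, Torus.IsSmooth
      (fun y => ⟪fluxJacobian σ j (consState (ρ s y) (u s y) (θ s y)) (V s y), ψ s y⟫_ℝ) :=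
    fun j => (isSmooth_clm_apply (hA j s hs) (hV.smooth.isSmooth_slice hsT)).inner
      (hψ.smooth.isSmooth_slice hs)
  have hpt : ∀ x, Torus.timeDerivWithin (Icc 0 t) (fun τ y => ⟪V τ y, ψ τ y⟫_ℝ) s x =
      -∑ j, Torus.partialDeriv j
        (fun y => ⟪fluxJacobian σ j (consState (ρ s y) (u s y) (θ s y)) (V s y), ψ s y⟫_ℝ) x := by
    intro x
    rw [hV'.timeDerivWithin_inner hψ.smooth hU hs x, hVt, add_comm,
      hV.inner_timeDerivWithin_add hψ htT hs (fun j => hA j s hs) x]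
  have hzero : ∫ x, Torus.timeDerivWithin (Icc 0 t) (fun τ y => ⟪V τ y, ψ τ y⟫_ℝ) s x = 0 := by
    simp_rw [hpt]
    rw [integral_neg, integral_finsetSum _ fun j _ => ((hw j).partialDeriv j).integrable]
    rw [Finset.sum_eq_zero fun j _ => Torus.integral_partialDeriv_eq_zero_holds (hw j) j, neg_zero]
  rwa [hzero] at hderiv

/-- **Conservation of the duality pairing.** Under the hypotheses of
`hasDerivWithinAt_integral_inner`: `∫ ⟪V(s,x), ψ(s,x)⟫ dx = ∫ ⟪V(t,x), ψ(t,x)⟫ dx` for every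
`s ∈ [0,t]`. With terminal datum `ψ(t) = χ eₖ` this reads
`∫ χ (V(t))ₖ = ∫ ⟪V(0,x), ψ(0,x)⟫ dx`: the response of the `k`-th conserved field at time `t` is
the initial perturbation paired with the backward adjoint solution. [folklore] -/
theorem integral_inner_eq (hV : IsLinearizedHsEulerSolution σ T ρ u θ V)
    (hψ : IsAdjointLinearizedHsEulerSolution σ t ρ u θ ψ) (htT : t < T)
    (hA : ∀ j, ∀ s ∈ Icc 0 t,
      Torus.IsSmooth (fun y => fluxJacobian σ j (consState (ρ s y) (u s y) (θ s y))))
    {s : ℝ} (hs : s ∈ Icc 0 t) :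
    ∫ x, ⟪V s x, ψ s x⟫_ℝ = ∫ x, ⟪V t x, ψ t x⟫_ℝ := by
  rcases eq_or_lt_of_le hs.1 with h0s | h0s
  · -- `s = 0`; if moreover `t = 0` there is nothing to prove
    rcases eq_or_lt_of_le (hs.1.trans hs.2) with h0t | h0t
    · subst h0s; subst h0t; rfl
    · subst h0s
      have key := constant_of_derivWithin_zero
        (f := fun τ => ∫ x, ⟪V τ x, ψ τ x⟫_ℝ) (a := 0) (b := t)
        (fun τ hτ => (hV.hasDerivWithinAt_integral_inner hψ htT h0t hA hτ).differentiableWithinAt)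
        (fun τ hτ => (hV.hasDerivWithinAt_integral_inner hψ htT h0t hA
          (Ico_subset_Icc_self hτ)).derivWithin (uniqueDiffOn_Icc h0t τ (Ico_subset_Icc_self hτ)))
      exact (key t (right_mem_Icc.2 h0t.le)).symm
  · have h0t : 0 < t := h0s.trans_le hs.2
    have key := constant_of_derivWithin_zero
      (f := fun τ => ∫ x, ⟪V τ x, ψ τ x⟫_ℝ) (a := 0) (b := t)
      (fun τ hτ => (hV.hasDerivWithinAt_integral_inner hψ htT h0t hA hτ).differentiableWithinAt)
      (fun τ hτ => (hV.hasDerivWithinAt_integral_inner hψ htT h0t hA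
        (Ico_subset_Icc_self hτ)).derivWithin (uniqueDiffOn_Icc h0t τ (Ico_subset_Icc_self hτ)))
    rw [key s hs, key t (right_mem_Icc.2 h0t.le)]

/-- **Green's-function form of the duality.** With the terminal datum `ψ(t, x) = χ(x) eₖ`
(test the `k`-th conserved field — `k = 0` density, `k = j + 1` momentum, `k = 4` energy —
against `χ`), the time-`t` response is the initial perturbation paired with the backward adjoint
solution at time `0`: `∫ χ(x) V(t,x)ₖ dx = ∫ ⟪V(0,x), ψ(0,x)⟫ dx`. [folklore] -/
theorem integral_mul_apply_eq_integral_inner (hV : IsLinearizedHsEulerSolution σ T ρ u θ V)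
    (hψ : IsAdjointLinearizedHsEulerSolution σ t ρ u θ ψ) (htT : t < T) (ht : 0 ≤ t)
    (hA : ∀ j, ∀ s ∈ Icc 0 t,
      Torus.IsSmooth (fun y => fluxJacobian σ j (consState (ρ s y) (u s y) (θ s y))))
    {χ : T3 → ℝ} {k : Fin 5} (hterm : ψ t = fun x => χ x • EuclideanSpace.single k 1) :
    ∫ x, χ x * V t x k = ∫ x, ⟪V 0 x, ψ 0 x⟫_ℝ := by
  rw [hV.integral_inner_eq hψ htT hA (left_mem_Icc.2 ht), hterm]
  simp [inner_smul_right, EuclideanSpace.inner_single_right]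

end IsLinearizedHsEulerSolution

end Literature.Analysis.FluidPDE

end
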